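import Summits.QuantumFields.YangMills.Theorems.ContinuumLimitOnTrajectory.Negative.ContinuumLimitOnTrajectoryFalseOfKernelBlowUp
import HarnessLib

/-!
# `ContinuumLimitOnTrajectory` — negative-side support X: the lattice two-point kernel has ONE scale under (A);
# (A) is false modulo a TWO-SCALE kernel witness (the torus-seam misstatement, scale-free form)

Support file for crux `stmt-QuantumFields-10522` ((A) of `ParabolicTrajectory`), by the line lead (seat c4,
`prover-line-stmt-QuantumFields-10522-c4-0`); sequel and CORRECTION of `…FalseOfKernelBlowUp` (same seat). That file's
hypothesis `KernelBlowUp` asks the UNIT-normalised curvature kernel `K_{a,β,L}(f, g)` (weight `a⁴` per site, bulk values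
`O(a_k⁸) → 0`) to diverge ABSOLUTELY along an admissible sequence while compact pairs stay absolutely bounded — a true
implication, but NOT what the torus seam delivers: on a slow-volume admissible scheme the fat-tailed pair wrapped around the
seam of the smearing box is `≈ a_k⁵ I_fg(ℓ_k) χ_k`, i.e. `≫ a_k⁸` but still `→ 0`
(`Cruxes/ContinuumLimitOnTrajectory/SEAM-two-orbit-synchronisation.md` §§1–3). The seam's content is a statement about TWO
SCALES, and the rigidity argument is scale-free. This file runs it against arbitrary positive weights `w_k`:

* `eventually_abs_kernel_le_weight_of_isYangMillsFor` — pinning transfers the scale: OS data tied by `IsYangMillsFor`,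
  non-trivial in `tr F²`, kernels `O(w_k)` on compactly supported time-separated real pairs ⇒ `O(w_k)` on every
  time-separated real Schwartz pair (a compact non-trivial pair — `exists_compact_truncated_ne_zero_of_isNontrivial` of the
  prequel — pins `c_k² w_k` below; `c_k² K_k(f,g)` converges);
* `continuumLimitOnTrajectory_imp_oneKernelScale` — **necessary condition (V′) of (A)**: along every admissible sequence and
  for every `w_k > 0`, compact pairs `O(w_k)` ⇒ all time-separated Schwartz pairs `O(w_k)` — Wilson lattice expectations only;
* `KernelScaleBlowUp` — the hypothesis `H`: an admissible sequence of (A)'s block and weights `w_k > 0` (physically `a_k⁸`)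
  with `O(w_k)` kernels on compactly supported time-separated pairs (a `UVB`-type bulk bound) but ONE time-separated Schwartz
  pair with `|K_k(f, g)| / w_k → ∞` (the seam: `a_k⁻³ I_fg(ℓ_k) χ_k → ∞` on slow-volume schemes, from the slab
  susceptibility `χ_k ≳ β_k^{-2}` — cf. `PlaquetteCovNonneg` / `AdjacentCovLowerBound` of `BalabanStepParabolic/Negative/FaceContact`);
  an admissible sequence at all is (S)+(B) at weak coupling (open), so `H` is not constructible in the tree today;
* `continuumLimitOnTrajectory_false_of_kernelScaleBlowUp : KernelScaleBlowUp → ¬ ContinuumLimitOnTrajectory`.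

Classification for the planner: refuted-MISSTATED modulo `H`; the construction item filed for the prequel's `KernelBlowUp`
should be CLOSED in favour of `KernelScaleBlowUp`; repair (A) by the volume-growth clause (`ContinuumLimitOnTrajectoryPVG`,
…DefsF), under which no Schwartz pair sees the seam.
-/

namespace Summit.QuantumFields.YangMills.Theorems.ContinuumLimitOnTrajectory.Negative

open MeasureTheory Filter Topology Complex
open scoped SchwartzMap
open Literature.MathematicalPhysics.QuantumFieldTheory Literature.MathematicalPhysics.QuantumLattice
open Literature.MathematicalPhysics.AQFT (IsOffDiagonal)
open Summit.QuantumFields.YangMills.Theses.ParabolicTrajectory (ContinuumLimitOnTrajectory)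

noncomputable section

/-! ## §1 Pinning transfers the scale -/

section Weighted

variable {G : Type} [Group G] [TopologicalSpace G] [IsTopologicalGroup G] [CompactSpace G]
  [MeasurableSpace G] [BorelSpace G]

/-- **Pinning transfers the scale.** Fix any positive weights `w_k` (the physical choice is the bulk scale
`w_k = a_k⁸` of the unit-normalised kernel). If OS data tied to `sch` by `IsYangMillsFor` are non-trivial in `tr F²`
and the unit-normalised kernels of all COMPACTLY SUPPORTED time-separated real pairs are eventually `O(w_k)` along the
bare data `(a_k, β_k, L_k)`, then so is the kernel of EVERY time-separated real Schwartz pair: a compact non-trivial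
pair `(u, v)` pins `c_k² w_k ≥ |𝔖₂ᵀ(u⊗v)| / (2B)` eventually (`c_k² K_k(u,v) → 𝔖₂ᵀ(u⊗v) ≠ 0`, `|K_k(u,v)| ≤ B w_k`),
and `c_k² K_k(f,g)` converges. [folklore] -/
theorem eventually_abs_kernel_le_weight_of_isYangMillsFor (r : LatticeRep G) (sch : SpeciesScheme (YMSpecies G))
    (T : OSData (YMSpecies G) 4) (hT : IsYangMillsFor r sch T) (hNT : T.IsNontrivial r.curvature)
    {w : ℕ → ℝ} (hw : ∀ k, 0 < w k)
    (hbdd : ∀ u v : 𝓢((EuclideanSpace ℝ (Fin 4)), ℝ), tsupport (u : (EuclideanSpace ℝ (Fin 4)) → ℝ) ⊆ {z | z 0 < 0} →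
      tsupport (v : (EuclideanSpace ℝ (Fin 4)) → ℝ) ⊆ {z | 0 < z 0} →
      HasCompactSupport (u : (EuclideanSpace ℝ (Fin 4)) → ℝ) → HasCompactSupport (v : (EuclideanSpace ℝ (Fin 4)) → ℝ) →
        ∃ B : ℝ, ∀ᶠ k in atTop, |twoPointKernel r.ρ (sch.a k) (sch.β k) (sch.L k) u v| ≤ B * w k)
    {f g : 𝓢((EuclideanSpace ℝ (Fin 4)), ℝ)} (hf : tsupport (f : (EuclideanSpace ℝ (Fin 4)) → ℝ) ⊆ {z | z 0 < 0})
    (hg : tsupport (g : (EuclideanSpace ℝ (Fin 4)) → ℝ) ⊆ {z | 0 < z 0}) :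
    ∃ B' : ℝ, ∀ᶠ k in atTop, |twoPointKernel r.ρ (sch.a k) (sch.β k) (sch.L k) f g| ≤ B' * w k := by
  obtain ⟨u, v, hu, hv, huc, hvc, hne⟩ := exists_compact_truncated_ne_zero_of_isNontrivial T r.curvature hNT
  obtain ⟨B, hB⟩ := hbdd u v hu hv huc hvc
  have huv : IsOffDiagonal (T2 u v) := isOffDiagonal_T2 hu hv
  have hfg : IsOffDiagonal (T2 f g) := isOffDiagonal_T2 hf hg
  -- the two limits
  have hKuv := tendsto_c_sq_mul_kernel r sch T hT huv
  have hKfg := tendsto_c_sq_mul_kernel r sch T hT hfg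
  set L : ℂ := S2T T r.curvature u v with hL
  set L' : ℂ := S2T T r.curvature f g with hL'
  have hLpos : 0 < ‖L‖ := norm_pos_iff.2 hne
  -- eventually ‖c² K(u,v)‖ ≥ ‖L‖/2 and ‖c² K(f,g)‖ ≤ ‖L'‖ + 1
  have h1 : ∀ᶠ k in atTop, ‖L‖ / 2 ≤ |(sch.c r.curvature k) ^ 2 *
      twoPointKernel r.ρ (sch.a k) (sch.β k) (sch.L k) u v| := by
    have hball := hKuv.eventually (Metric.ball_mem_nhds L (half_pos hLpos))
    filter_upwards [hball] with k hk
    rw [dist_eq_norm] at hk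
    have htri : ‖L‖ ≤ ‖(((sch.c r.curvature k) ^ 2 *
        twoPointKernel r.ρ (sch.a k) (sch.β k) (sch.L k) u v : ℝ) : ℂ)‖ +
        ‖(((sch.c r.curvature k) ^ 2 * twoPointKernel r.ρ (sch.a k) (sch.β k) (sch.L k) u v : ℝ) : ℂ) - L‖ :=
      norm_le_insert _ _
    rw [Complex.norm_real, Real.norm_eq_abs] at htri
    linarith
  have h2 : ∀ᶠ k in atTop, |(sch.c r.curvature k) ^ 2 *
      twoPointKernel r.ρ (sch.a k) (sch.β k) (sch.L k) f g| ≤ ‖L'‖ + 1 := by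
    have hball := hKfg.eventually (Metric.ball_mem_nhds L' one_pos)
    filter_upwards [hball] with k hk
    rw [dist_eq_norm] at hk
    have htri : ‖(((sch.c r.curvature k) ^ 2 *
        twoPointKernel r.ρ (sch.a k) (sch.β k) (sch.L k) f g : ℝ) : ℂ)‖ ≤ ‖L'‖ +
        ‖(((sch.c r.curvature k) ^ 2 * twoPointKernel r.ρ (sch.a k) (sch.β k) (sch.L k) f g : ℝ) : ℂ) - L'‖ :=
      norm_le_insert' _ _
    rw [Complex.norm_real, Real.norm_eq_abs] at htri
    linarith
  refine ⟨(‖L'‖ + 1) * (2 * max B 1 / ‖L‖), ?_⟩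
  filter_upwards [h1, h2, hB] with k hk1 hk2 hkB
  set c2 : ℝ := (sch.c r.curvature k) ^ 2 with hc2
  set Kuv : ℝ := twoPointKernel r.ρ (sch.a k) (sch.β k) (sch.L k) u v with hKuv_def
  set Kfg : ℝ := twoPointKernel r.ρ (sch.a k) (sch.β k) (sch.L k) f g with hKfg_def
  have hwk : 0 < w k := hw k
  have hc2nn : 0 ≤ c2 := by rw [hc2]; positivity
  have hB1 : |Kuv| ≤ max B 1 * w k :=
    hkB.trans (mul_le_mul_of_nonneg_right (le_max_left _ _) hwk.le)
  have hmaxpos : 0 < max B 1 := lt_of_lt_of_le one_pos (le_max_right _ _)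
  -- pin c² from below: ‖L‖/2 ≤ c² |Kuv| ≤ c² (max B 1) w_k
  have hpin : ‖L‖ / 2 ≤ c2 * (max B 1 * w k) := by
    rw [abs_mul, abs_of_nonneg hc2nn] at hk1
    exact hk1.trans (mul_le_mul_of_nonneg_left hB1 hc2nn)
  have hc2pos : 0 < c2 := by
    by_contra h0
    have : c2 = 0 := le_antisymm (not_lt.1 h0) hc2nn
    rw [this, zero_mul] at hpin
    linarith
  -- c2⁻¹ ≤ 2 (max B 1) w_k / ‖L‖
  have hinv : c2⁻¹ ≤ 2 * max B 1 * w k / ‖L‖ := by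
    rw [inv_le_iff_one_le_mul₀ hc2pos, div_mul_eq_mul_div, one_le_div hLpos]
    nlinarith
  rw [abs_mul, abs_of_nonneg hc2nn] at hk2
  calc |Kfg| = c2⁻¹ * (c2 * |Kfg|) := by field_simp
    _ ≤ c2⁻¹ * (‖L'‖ + 1) := mul_le_mul_of_nonneg_left hk2 (inv_nonneg.2 hc2nn)
    _ ≤ (2 * max B 1 * w k / ‖L‖) * (‖L'‖ + 1) :=
        mul_le_mul_of_nonneg_right hinv (by positivity)
    _ = (‖L'‖ + 1) * (2 * max B 1 / ‖L‖) * w k := by ring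

end Weighted

/-! ## §2 Necessary condition (V′) of (A) and the scale-free negative lemma -/

/-- **Necessary condition (V) of (A): the lattice two-point kernel has ONE scale.** Under
`ContinuumLimitOnTrajectory`, along every sequence of its hypothesis block and for every choice of positive weights
`w_k` (physically `w_k = a_k⁸`, the bulk scale of the unit-normalised kernel): if the unit-normalised curvature
two-point kernels `K_{a_k,β_k,L_k}(u, v)` of all compactly supported time-separated real pairs are eventually
`O(w_k)`, then the kernel of EVERY time-separated real Schwartz pair is eventually `O(w_k)`. A statement about
Wilson lattice expectations alone (no renormalisation constant, no OS datum). Its failure along a slow-volume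
admissible scheme — bulk pairs `O(a_k⁸)`, a fat-tailed pair wrapped around the torus seam `≫ a_k⁸` — is the
torus-seam mechanism. [folklore] -/
theorem continuumLimitOnTrajectory_imp_oneKernelScale (h : ContinuumLimitOnTrajectory) :
    ∀ (G : Type) [Group G] [TopologicalSpace G] [IsTopologicalGroup G] [CompactSpace G],
      IsCompactSimpleLieGroup G →
        letI : MeasurableSpace G := borel G
        haveI : BorelSpace G := ⟨rfl⟩
        ∀ r : LatticeRep G, ∃ M₀ : ℕ, ∀ M : ℕ, M₀ ≤ M → 2 ≤ M → ∃ θ₀ : ℝ, 0 < θ₀ ∧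
          ∀ (θ Δ : ℝ) (sch : SpeciesScheme (YMSpecies G)) (n : ℕ → ℕ) (w : ℕ → ℝ), 0 < θ → θ < θ₀ → 0 < Δ →
          (∀ k, sch.a k = ((M : ℝ) ^ n k)⁻¹) → Tendsto sch.β atTop atTop →
          (∀ t : ℕ, 0 < t → ∃ c : ℝ, Tendsto (fun k => ((M : ℝ) ^ n k) ^ 8 *
            latticeConnectedCorr r.ρ (sch.β k) (sch.side k) r.curvature.F r.curvature.F (t * M ^ n k))
              atTop (𝓝 c)) →
          Tendsto (fun k => ((M : ℝ) ^ n k) ^ 8 *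
            latticeConnectedCorr r.ρ (sch.β k) (sch.side k) r.curvature.F r.curvature.F (M ^ n k))
              atTop (𝓝 θ) →
          HasLatticeMassGap r sch Δ → (∀ k, 0 < w k) →
          (∀ u v : 𝓢((EuclideanSpace ℝ (Fin 4)), ℝ), tsupport (u : (EuclideanSpace ℝ (Fin 4)) → ℝ) ⊆ {z | z 0 < 0} → tsupport (v : (EuclideanSpace ℝ (Fin 4)) → ℝ) ⊆ {z | 0 < z 0} →
            HasCompactSupport (u : (EuclideanSpace ℝ (Fin 4)) → ℝ) → HasCompactSupport (v : (EuclideanSpace ℝ (Fin 4)) → ℝ) →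
              ∃ B : ℝ, ∀ᶠ k in atTop, |twoPointKernel r.ρ (sch.a k) (sch.β k) (sch.L k) u v| ≤ B * w k) →
          ∀ f g : 𝓢((EuclideanSpace ℝ (Fin 4)), ℝ), tsupport (f : (EuclideanSpace ℝ (Fin 4)) → ℝ) ⊆ {z | z 0 < 0} → tsupport (g : (EuclideanSpace ℝ (Fin 4)) → ℝ) ⊆ {z | 0 < z 0} →
            ∃ B' : ℝ, ∀ᶠ k in atTop, |twoPointKernel r.ρ (sch.a k) (sch.β k) (sch.L k) f g| ≤ B' * w k := by
  intro G _ _ _ _ hG r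
  letI : MeasurableSpace G := borel G
  haveI : BorelSpace G := ⟨rfl⟩
  obtain ⟨M₀, hM₀⟩ := h G hG r
  refine ⟨M₀, fun M hM h2 => ?_⟩
  obtain ⟨θ₀, hθ₀, hθ⟩ := hM₀ M hM h2
  refine ⟨θ₀, hθ₀, fun θ Δ sch n w h0 h1 hΔ ha hb hc hd he hw hbdd f g hf hg => ?_⟩
  obtain ⟨sch', ha', hβ', hL', T, hYM, hNT, -⟩ := hθ θ Δ sch n h0 h1 hΔ ha hb hc hd he
  have hbdd' : ∀ u v : 𝓢((EuclideanSpace ℝ (Fin 4)), ℝ), tsupport (u : (EuclideanSpace ℝ (Fin 4)) → ℝ) ⊆ {z | z 0 < 0} →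
      tsupport (v : (EuclideanSpace ℝ (Fin 4)) → ℝ) ⊆ {z | 0 < z 0} → HasCompactSupport (u : (EuclideanSpace ℝ (Fin 4)) → ℝ) → HasCompactSupport (v : (EuclideanSpace ℝ (Fin 4)) → ℝ) →
        ∃ B : ℝ, ∀ᶠ k in atTop, |twoPointKernel r.ρ (sch'.a k) (sch'.β k) (sch'.L k) u v| ≤ B * w k := by
    intro u v hu hv huc hvc
    simpa only [ha', hβ', hL'] using hbdd u v hu hv huc hvc
  have key := eventually_abs_kernel_le_weight_of_isYangMillsFor r sch' T hYM hNT hw hbdd' hf hg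
  simpa only [ha', hβ', hL'] using key

/-- **The two-scale kernel hypothesis `H` (`KernelScaleBlowUp`)** (precise; NOT constructible in the tree today). Some compact simple `G`,
lattice representation `r`, cofinally many block factors `M ≥ 2` and, for every window `θ₀ > 0`, an ADMISSIBLE
sequence of (A)'s hypothesis block (`M`-adic shape, `β_k → ∞`, convergent towers, tuning `θ ∈ (0, θ₀)`, uniform
lattice gap `Δ > 0`) with positive weights `w_k` along which the unit-normalised curvature two-point kernels of
compactly supported time-separated real pairs are `O(w_k)` while ONE time-separated real Schwartz pair has
`|K_k(f, g)| / w_k → ∞` — the kernel has two scales. The torus-seam report derives it with `w_k = a_k⁸` for every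
slow-volume admissible scheme (`liminf log(a_k L_k)/log a_k⁻¹ = 0`: bulk pairs `O(a_k⁸)` by a `UVB`-type bound, a
fat-tailed pair `≈ a_k⁵ I_fg(ℓ_k) χ_k ≫ a_k⁸` from the slab susceptibility `χ_k ≳ β_k^{-2}`); an admissible scheme at
all is an instance of (S)+(B) at weak coupling (open). -/
def KernelScaleBlowUp : Prop :=
  ∃ (G : Type) (_ : Group G) (_ : TopologicalSpace G) (_ : IsTopologicalGroup G) (_ : CompactSpace G),
    IsCompactSimpleLieGroup G ∧
      letI : MeasurableSpace G := borel G
      haveI : BorelSpace G := ⟨rfl⟩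
      ∃ r : LatticeRep G, ∀ M₀ : ℕ, ∃ M : ℕ, M₀ ≤ M ∧ 2 ≤ M ∧ ∀ θ₀ : ℝ, 0 < θ₀ →
        ∃ (θ Δ : ℝ) (sch : SpeciesScheme (YMSpecies G)) (n : ℕ → ℕ) (w : ℕ → ℝ), 0 < θ ∧ θ < θ₀ ∧ 0 < Δ ∧
          (∀ k, sch.a k = ((M : ℝ) ^ n k)⁻¹) ∧ Tendsto sch.β atTop atTop ∧
          (∀ t : ℕ, 0 < t → ∃ c : ℝ, Tendsto (fun k => ((M : ℝ) ^ n k) ^ 8 *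
            latticeConnectedCorr r.ρ (sch.β k) (sch.side k) r.curvature.F r.curvature.F (t * M ^ n k))
              atTop (𝓝 c)) ∧
          Tendsto (fun k => ((M : ℝ) ^ n k) ^ 8 *
            latticeConnectedCorr r.ρ (sch.β k) (sch.side k) r.curvature.F r.curvature.F (M ^ n k))
              atTop (𝓝 θ) ∧
          HasLatticeMassGap r sch Δ ∧ (∀ k, 0 < w k) ∧
          (∀ u v : 𝓢((EuclideanSpace ℝ (Fin 4)), ℝ), tsupport (u : (EuclideanSpace ℝ (Fin 4)) → ℝ) ⊆ {z | z 0 < 0} → tsupport (v : (EuclideanSpace ℝ (Fin 4)) → ℝ) ⊆ {z | 0 < z 0} →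
            HasCompactSupport (u : (EuclideanSpace ℝ (Fin 4)) → ℝ) → HasCompactSupport (v : (EuclideanSpace ℝ (Fin 4)) → ℝ) →
              ∃ B : ℝ, ∀ᶠ k in atTop, |twoPointKernel r.ρ (sch.a k) (sch.β k) (sch.L k) u v| ≤ B * w k) ∧
          ∃ f g : 𝓢((EuclideanSpace ℝ (Fin 4)), ℝ), tsupport (f : (EuclideanSpace ℝ (Fin 4)) → ℝ) ⊆ {z | z 0 < 0} ∧ tsupport (g : (EuclideanSpace ℝ (Fin 4)) → ℝ) ⊆ {z | 0 < z 0} ∧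
            Tendsto (fun k => |twoPointKernel r.ρ (sch.a k) (sch.β k) (sch.L k) f g| / w k) atTop atTop

/-- **`¬ ContinuumLimitOnTrajectory` modulo the kernel blow-up hypothesis.** Under `H` the crux (A) as typed is
false: (A)'s necessary condition (V) (`continuumLimitOnTrajectory_imp_oneKernelScale`) makes the blowing-up pair
`O(w_k)`. Classification: refuted-MISSTATED modulo `H` — the witness `H` lives on slow-volume schemes only; repair (A)
by the volume-growth clause (`ContinuumLimitOnTrajectoryPVG`, …DefsF), which every line of the crux already threads. -/
theorem continuumLimitOnTrajectory_false_of_kernelScaleBlowUp (hH : KernelScaleBlowUp) : ¬ ContinuumLimitOnTrajectory := by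
  intro hA
  obtain ⟨G, _, _, _, _, hG, r, hr⟩ := hH
  letI : MeasurableSpace G := borel G
  haveI : BorelSpace G := ⟨rfl⟩
  obtain ⟨M₀, hM₀⟩ := continuumLimitOnTrajectory_imp_oneKernelScale hA G hG r
  obtain ⟨M, hM, h2, hwin⟩ := hr M₀
  obtain ⟨θ₀, hθ₀, hθ⟩ := hM₀ M hM h2
  obtain ⟨θ, Δ, sch, n, w, h0, h1, hΔ, ha, hb, hc, hd, he, hw, hbdd, f, g, hf, hg, hblow⟩ := hwin θ₀ hθ₀
  obtain ⟨B', hB'⟩ := hθ θ Δ sch n w h0 h1 hΔ ha hb hc hd he hw hbdd f g hf hg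
  obtain ⟨k, hk1, hk2⟩ := (hB'.and (hblow.eventually_gt_atTop B')).exists
  have hwk : 0 < w k := hw k
  have : |twoPointKernel r.ρ (sch.a k) (sch.β k) (sch.L k) f g| / w k ≤ B' := by
    rw [div_le_iff₀ hwk]
    exact hk1
  exact absurd this (not_le.2 hk2)

end

end Summit.QuantumFields.YangMills.Theorems.ContinuumLimitOnTrajectory.Negative
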